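import Summits.QuantumFields.BalabanUV.T4Continuum.Support.NE7HessDominatesCoarseCurl
import HarnessLib

/-!
# NE7SlicedCoarseCurlLowerBound — THE FINE WILSON HESSIAN BOUNDS THE COARSE MAXWELL ENERGY OF THE CONSTRAINT DIFFERENTIAL FROM ABOVE ON FRAME-FREE FIBRE ELEMENTS OBEYING A
# SCALED-MASS POINCARÉ BOUND (displayed): `Σ_P ‖curl_{V₀} ṽ(P)‖²_{HS∕n} ≤ ((1+θ) + 2·K(ε,θ)·C_P)·hess U X̃ X̃ (perWin) + 2·K(ε,θ)·R`, d = 4, j-UNIFORM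
# (lineage `b2b-balaban-t4-ne7-p1`, gen 117, file F9; ROAD-G117 §4 (S1) — the algebraic closure of F7 under the two slice properties, each displayed as a hypothesis)

Cell `pub-balaban`, rung (B)+1 sub-cell t4, CRUX PROVER NE7 #1 (OWNER of row NE7), generation 117.  F7 ✓ `frameCorrected_coarse_curl_le_hess` leaves two slice-dependent items: the frame
commutator `frameComm` (it VANISHES on frame-free fields, `framePotW = 0` — the defining condition of row NE3's slice `frameFreeBlockLandauW`) and the scaled fine mass
`L^{−2(j+1)}·dirSq X̃` (on a block-Landau slice it is bounded by the fine curl energy plus coarse data: row NE3's (P♮)_W ✓ `NE3ClassSlicePoincare.classSlicePoincare_of_lines` for TANGENT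
fields, plus a lift of `v`).  THIS FILE performs the algebra with both items DISPLAYED AS HYPOTHESES on the given fibre element — `hff : framePotW L (j+1) U X̃ = 0` and
`hP : L^{−2(j+1)}·dirSq X̃ ≤ C_P·Σ_p nhsNormSq (curl U X̃ p) + R` (`C_P, R ≥ 0`; `R` = the coarse-data∕lift terms) — under the absorption line `28·#planes·ε·C_P ≤ 1`:
  **`Σ_{P∈perWin N} nhsNormSq (curl V₀ ṽ P) ≤ ((1+θ) + 2·K·C_P)·hess U X̃ X̃ (perWin 4 (tower L N (j+1))) + 2·K·R`**, `K = (1+θ)·14·#planes·ε + (1+θ⁻¹)·36·eC²·ε²`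
(every `θ > 0`; `ṽ = (levelQ' L N j U X)̃`, `V₀ = cavgIter L (j+1) U`) — so on such fibre elements `hess ≥ (1 − O(ε·(1 + C_P)))·Σ_P nhs(curl_{V₀}ṽ) − O(ε)·R`: the curved, j-uniform analogue
of gen 116's flat floor `Σ_P nhs(curl_1 ṽ) ≤ D²m_1(0)[v,v]`, modulo the displayed slice properties and the multiplier term.
HONEST FRAMING: algebra over F7; `hff`, `hP` are HYPOTHESES on the fibre element (supplying them for every element of a slice transversal to the fine stabiliser orbit, and the multiplier term,
is the successor's (S1)(α)(β)); nothing of Bałaban's asserted; NOT (G′), NOT NE7 as a spine node, NOT NE3; spine 0∕9; finite T⁴ rung (B)+1 — NOT infinite volume, NOT mass gap, NOT BetaPertH,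
NOT Clay.
-/

set_option autoImplicit false

open scoped BigOperators Matrix Matrix.Norms.L2Operator
open NormedSpace Finset

namespace Summit.QuantumFields.BalabanUV.T4Continuum.NE7SlicedCoarseCurlLowerBound

open Literature.MathematicalPhysics.QuantumFieldTheory.Balaban1983to89
open B7Prop1Explicit B7Prop2Explicit MatrixLog UnitaryModel
open T4AveragingDeficitWall (IsUnitaryCfg IsSkewDir SmallField Ad curl curlAt dirSq)
open T4AveragingDeficitWallBoundary (IsPeriodicCfg periodBox)
open AveragingDeficitPeriodicCounting (IsPeriodicDir)
open AveragingDeficitTorusChart (TDir chartDir isPeriodicDir_chartDir)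
open AveragingDeficitNearIdentity (Ad_zero)
open AveragingDeficitTwoLevelPrep (twoLevelSmall skewSub)
open AveragingDeficitMultiLevelPrep (cavgIter tower levelQ' tower_ne_zero)
open MatrixNorms (nhsNormSq nhsNormSq_nonneg)
open MinimalActionLevels (perWin)
open NE3HessForm (hess)
open NE3HessBounds (bondSq)
open NE3TangentCovariantTower (framePotW)
open NE3EnergyHessContTwoTerm (dirSq_nonneg)
open NE7RadIterUniform (radD)
open NE7StraightTowerCurlEnergy (eC mC eC_nonneg)
open NE7FrameCorrectedCurlEnergyTower (frameComm)
open NE7HessDominatesCoarseCurl (frameCorrected_coarse_curl_le_hess hess_self_ge_nhs sum_bondSq_perWin_le)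
open NE7FlatAverageCurlCommutation (isSkewDir_chartDir_id)

noncomputable section

variable {n : Type*} [Fintype n] [DecidableEq n]

/-- On FRAME-FREE fields the frame commutator vanishes. [folklore] -/
theorem frameComm_eq_zero_of_frameFree {L j : ℕ} {U : Site 4 → Fin 4 → (Matrix n n ℂ)ˣ} {Y : Site 4 → Fin 4 → Matrix n n ℂ}
    (hff : ∀ z : Site 4, framePotW L (j + 1) U Y z = 0) (z : Site 4) (μ ν : Fin 4) : frameComm L j U Y z μ ν = 0 := by
  unfold NE7FrameCorrectedCurlEnergyTower.frameComm
  rw [hff z, Ad_zero, sub_zero]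
set_option maxHeartbeats 400000 in
/-- **THE COARSE MAXWELL ENERGY OF THE CONSTRAINT DIFFERENTIAL AGAINST THE FINE WILSON HESSIAN, ON FRAME-FREE FIBRE ELEMENTS WITH A DISPLAYED SCALED-MASS POINCARÉ BOUND** (d = 4,
j-UNIFORM): hypotheses of ✓ `frameCorrected_coarse_curl_le_hess`, plus `hff : framePotW L (j+1) U X̃ = 0`, `hP : (L⁻¹)^{2(j+1)}·dirSq X̃ ≤ C_P·Σ_p nhsNormSq (curl U X̃ p) + R` (`0 ≤ C_P`)
and the absorption line `28·#planes·ε·C_P ≤ 1`; then for every `θ > 0`, with `K := (1+θ)·14·#planes·ε + (1+θ⁻¹)·36·(eC 4 L ν)²·ε²`,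
`Σ_{P∈perWin N} nhsNormSq (curl V₀ ṽ P) ≤ ((1+θ) + 2·K·C_P)·hess U X̃ X̃ (perWin 4 (tower L N (j+1))) + 2·K·R`. [cite: Balaban1985Averaging, (48) p.25; Balaban1985BackgroundPropagators, (3.10) p.391] -/
theorem coarse_curl_le_hess_of_frameFree_poincare [Nonempty n] {L N : ℕ} [NeZero L] [NeZero N] (hL : 2 ≤ L) (hN : 1 ≤ N) {ε : ℝ} (hε : 0 ≤ ε)
    (hεD : 4 * ε * radD 4 L * (((L : ℝ) ^ 2)⁻¹) ^ 2 ≤ 1) (hεT : twoLevelSmall 4 L * (2 * ε * ((L : ℝ) ^ 2)⁻¹) ≤ 1)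
    (hεM : 8 * (L : ℝ) * mC 4 L (Fintype.card n) * ε * ((L : ℝ) ^ 2)⁻¹ ≤ 1) (j : ℕ)
    {U : Site 4 → Fin 4 → (Matrix n n ℂ)ˣ} (hU : IsUnitaryCfg U) (hUP : IsPeriodicCfg U ((tower L N (j + 1) : ℕ) : ℤ))
    (hUx : SmallField U (ε * (((L : ℝ) ^ 2)⁻¹) ^ (j + 1)))
    {X : TDir 4 n (L * tower L N j)} (hX : X ∈ skewSub 4 n (L * tower L N j))
    (hff : ∀ z : Site 4, framePotW L (j + 1) U (chartDir (ContinuousLinearMap.id ℝ (Matrix n n ℂ)) (L * tower L N j) X) z = 0)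
    {CP R : ℝ} (hCP : 0 ≤ CP)
    (hP : ((L : ℝ)⁻¹) ^ (2 * (j + 1)) * dirSq (chartDir (ContinuousLinearMap.id ℝ (Matrix n n ℂ)) (L * tower L N j) X) (periodBox (tower L N (j + 1)))
      ≤ CP * ∑ p ∈ perWin 4 (tower L N (j + 1)), nhsNormSq (curl U (chartDir (ContinuousLinearMap.id ℝ (Matrix n n ℂ)) (L * tower L N j) X) p) + R)
    (habs : 28 * (Fintype.card (T4AveragingDeficitWall.Plane 4) : ℝ) * ε * CP ≤ 1) {θ : ℝ} (hθ : 0 < θ) :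
    ∑ P ∈ perWin 4 N, nhsNormSq
        (curl (cavgIter L (j + 1) U) (chartDir (ContinuousLinearMap.id ℝ (Matrix n n ℂ)) N ((levelQ' L N j U X : ↥(skewSub 4 n N)) : TDir 4 n N)) P)
      ≤ ((1 + θ) + 2 * ((1 + θ) * (14 * (Fintype.card (T4AveragingDeficitWall.Plane 4) : ℝ) * ε) + (1 + θ⁻¹) * (36 * eC 4 L (Fintype.card n) ^ 2 * ε ^ 2)) * CP)
          * hess U (chartDir (ContinuousLinearMap.id ℝ (Matrix n n ℂ)) (L * tower L N j) X) (chartDir (ContinuousLinearMap.id ℝ (Matrix n n ℂ)) (L * tower L N j) X)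
              (perWin 4 (tower L N (j + 1)))
        + 2 * ((1 + θ) * (14 * (Fintype.card (T4AveragingDeficitWall.Plane 4) : ℝ) * ε) + (1 + θ⁻¹) * (36 * eC 4 L (Fintype.card n) ^ 2 * ε ^ 2)) * R := by
  have hT1 : 1 ≤ tower L N (j + 1) := Nat.one_le_iff_ne_zero.mpr (tower_ne_zero L N (j + 1))
  have hXts : IsSkewDir (chartDir (ContinuousLinearMap.id ℝ (Matrix n n ℂ)) (L * tower L N j) X) := isSkewDir_chartDir_id hX
  have hXtP : IsPeriodicDir (chartDir (ContinuousLinearMap.id ℝ (Matrix n n ℂ)) (L * tower L N j) X) ((tower L N (j + 1) : ℕ) : ℤ) :=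
    isPeriodicDir_chartDir (ContinuousLinearMap.id ℝ (Matrix n n ℂ)) (L * tower L N j) X
  -- names for the real quantities
  obtain ⟨E₀, hE₀⟩ : ∃ E₀ : ℝ, E₀ = ∑ p ∈ perWin 4 (tower L N (j + 1)), nhsNormSq (curl U (chartDir (ContinuousLinearMap.id ℝ (Matrix n n ℂ)) (L * tower L N j) X) p) := ⟨_, rfl⟩
  obtain ⟨S, hS⟩ : ∃ S : ℝ, S = dirSq (chartDir (ContinuousLinearMap.id ℝ (Matrix n n ℂ)) (L * tower L N j) X) (periodBox (tower L N (j + 1))) := ⟨_, rfl⟩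
  obtain ⟨H, hH⟩ : ∃ H : ℝ, H = hess U (chartDir (ContinuousLinearMap.id ℝ (Matrix n n ℂ)) (L * tower L N j) X) (chartDir (ContinuousLinearMap.id ℝ (Matrix n n ℂ)) (L * tower L N j) X)
      (perWin 4 (tower L N (j + 1))) := ⟨_, rfl⟩
  obtain ⟨q2, hq2⟩ : ∃ q2 : ℝ, q2 = ((L : ℝ)⁻¹) ^ (2 * (j + 1)) := ⟨_, rfl⟩
  obtain ⟨Pl, hPl⟩ : ∃ Pl : ℝ, Pl = (Fintype.card (T4AveragingDeficitWall.Plane 4) : ℝ) := ⟨_, rfl⟩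
  obtain ⟨K, hK⟩ : ∃ K : ℝ, K = (1 + θ) * (14 * Pl * ε) + (1 + θ⁻¹) * (36 * eC 4 L (Fintype.card n) ^ 2 * ε ^ 2) := ⟨_, rfl⟩
  have hq20 : 0 ≤ q2 := by rw [hq2]; positivity
  have hPl0 : 0 ≤ Pl := by rw [hPl]; positivity
  have hS0 : 0 ≤ S := by rw [hS]; exact dirSq_nonneg _ _
  have hE₀0 : 0 ≤ E₀ := by rw [hE₀]; exact Finset.sum_nonneg fun _ _ => nhsNormSq_nonneg _
  have hθ1 : 0 ≤ 1 + θ := by linarith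
  have hθ2 : 0 ≤ 1 + θ⁻¹ := by positivity
  have hK0 : 0 ≤ K := by rw [hK]; have := eC_nonneg 4 L (ν := (Fintype.card n : ℝ)); positivity
  -- F7 with vanishing frame commutator
  have hF7 := frameCorrected_coarse_curl_le_hess hL hN hε hεD hεT hεM j hU hUP hUx hX hθ
  have hzero : ∀ P ∈ perWin 4 N, nhsNormSq
      (curl (cavgIter L (j + 1) U) (chartDir (ContinuousLinearMap.id ℝ (Matrix n n ℂ)) N ((levelQ' L N j U X : ↥(skewSub 4 n N)) : TDir 4 n N)) P
        - frameComm L j U (chartDir (ContinuousLinearMap.id ℝ (Matrix n n ℂ)) (L * tower L N j) X) P.1 P.2.1.1 P.2.1.2)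
      = nhsNormSq (curl (cavgIter L (j + 1) U) (chartDir (ContinuousLinearMap.id ℝ (Matrix n n ℂ)) N ((levelQ' L N j U X : ↥(skewSub 4 n N)) : TDir 4 n N)) P) := by
    intro P _; rw [frameComm_eq_zero_of_frameFree hff, sub_zero]
  rw [Finset.sum_congr rfl hzero, ← hH, ← hS, ← hq2, ← hPl, ← hK] at hF7
  -- the fine Hessian bounds the fine curl energy: E₀ ≤ H + 14·Pl·ε·q2·S
  have hqq : (((L : ℝ) ^ 2)⁻¹) ^ (j + 1) = q2 := by rw [hq2, inv_pow, inv_pow, ← pow_mul]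
  have hhess := hess_self_ge_nhs hU hXts hUx (perWin 4 (tower L N (j + 1)))
  rw [← hE₀, ← hH, hqq] at hhess
  have hbond := sum_bondSq_perWin_le (d := 4) hT1 hXtP
  rw [← hS, ← hPl] at hbond
  have hE₀le : E₀ ≤ H + 14 * Pl * ε * q2 * S := by
    have h7 : 0 ≤ 7 * (ε * q2) := by positivity
    have := mul_le_mul_of_nonneg_left hbond h7
    nlinarith
  -- the displayed Poincaré bound, with the Hessian inserted, absorbed
  rw [← hq2, ← hS, ← hE₀] at hP
  have hmass : q2 * S ≤ 2 * CP * H + 2 * R := by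
    have h1 : q2 * S ≤ CP * (H + 14 * Pl * ε * q2 * S) + R := hP.trans (by nlinarith [mul_le_mul_of_nonneg_left hE₀le hCP])
    have h2 : CP * (14 * Pl * ε) * (q2 * S) ≤ (1 / 2) * (q2 * S) := by
      have h3 : CP * (14 * Pl * ε) ≤ 1 / 2 := by rw [hPl]; rw [hPl] at hPl0; nlinarith
      exact mul_le_mul_of_nonneg_right h3 (mul_nonneg hq20 hS0)
    nlinarith
  -- assemble
  calc ∑ P ∈ perWin 4 N, nhsNormSq (curl (cavgIter L (j + 1) U) (chartDir (ContinuousLinearMap.id ℝ (Matrix n n ℂ)) N ((levelQ' L N j U X : ↥(skewSub 4 n N)) : TDir 4 n N)) P)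
      ≤ (1 + θ) * H + K * q2 * S := hF7
    _ ≤ (1 + θ) * H + K * (2 * CP * H + 2 * R) := by rw [mul_assoc]; exact add_le_add le_rfl (mul_le_mul_of_nonneg_left hmass hK0)
    _ = ((1 + θ) + 2 * K * CP) * H + 2 * K * R := by ring
    _ = _ := by rw [hK, hPl, hH]

end

end Summit.QuantumFields.BalabanUV.T4Continuum.NE7SlicedCoarseCurlLowerBound
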